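import Literature.NumberTheory.NumberFields.ImaginaryAbelianClassGroupOddPartBernoulliTowerProofs
import Literature.NumberTheory.NumberFields.ImaginaryAbelianClassGroupOddPartBernoulliCyclotomicSubfieldProofs
import Literature.NumberTheory.GaloisRepresentations.KroneckerWeberTheorem
import HarnessLib

/-!
# The Herbrand–Stickelberger direction of Mazur–Wiles' Theorem 2 for EVERY abelian number field:
# `‖B_{1,χ⁻¹}‖_p = 1 ⟹ A_K^θ = 0`, with the hypotheses of the named fact verbatim

Topic `Literature/NumberTheory/NumberFields`, namespace `Literature.NumberTheory.NumberFields`.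
THEOREMS ONLY: no definition, no named fact, no `sorry`, no instance, no notation (D-0014 ∕ D-0026:
net Literature debt 0). Fifth and last file of the series
`ImaginaryAbelianClassGroupOddPartBernoulli{Proofs, SubfieldProofs, TowerProofs, CyclotomicSubfieldProofs}.lean`:
the assembly. For an ABSTRACT finite abelian `K/ℚ` (`IsAbelianGalois ℚ K`, exactly as the named fact
`MazurWiles1984.thm2_oddChiPart_classGroup_card_eq_pow_val_bernoulli` quantifies) with `p ∤ [K : ℚ]`,
a character `θ : Gal(K/ℚ) → ℤ_pˣ` whose Dirichlet avatar `χ` mod `f` is primitive, odd and not `ω`, and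
`‖B_{1,χ⁻¹}‖_p = 1`, the `θ`-part of the `p`-class group of `K` is trivial. Road (Solomon's Rem. II.1:
«Stickelberger's Theorem shows that it annihilates `(Cl(K) ⊗ 𝓞)^χ` which allows us to deduce Theorem II.1
in this case», made unconditional of `K`): Kronecker–Weber (tree `KroneckerWeber_holds`, PROVED) puts
`K` inside some `M = ℚ(μ_n)`, `f ∣ n`; the field `K₁ = K^{ker θ}` cut out by `θ` lies inside
`F₀ = ℚ(μ_f) ⊆ M` (the inflation of `θ` to `Gal(M/ℚ)` is `χ ∘ c_n`, trivial on `Gal(M/ℚ(μ_f))`);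
Stickelberger's theorem for `K₁ ⊆ ℚ(μ_f)` (fourth file, Washington Thm. 6.10 on the `θ`-eigenspace, no
degree hypothesis) kills `e_{θ₁}(ℤ_p ⊗ Cl K₁)`; and the norm `K₁ ← K` (third file §2, «independent of `K`»
for `p ∤ [K:ℚ]`, Solomon §I) transports this up to `K`. HONEST FRAMING: this is the classical
(Stickelberger–Herbrand) half `#A_K^θ ∣ …`-free statement `B_{1,χ⁻¹} ∈ ℤ_pˣ ⟹ A_K^θ = 0`; the named fact
(the EQUALITY `#A_K^θ = p^{v_p(B_{1,χ⁻¹})}`, Mazur–Wiles) is NOT discharged — its other half is the Main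
Conjecture; no summit statement (BSD) and no conjunct of one is proved here. What the consumers of the
named fact actually use — `classGroupChiCard_eq_one_of_norm_generalizedBernoulli_eq_one (h : thm2…)` of
`ImaginaryAbelianClassGroupOddPartBernoulli.lean` — is now available WITHOUT the hypothesis `h`, as
`classGroupChiCard_eq_one_of_norm_generalizedBernoulli_eq_one_of_isAbelianGalois` below (same binders,
`p ≠ 2` not needed).

## Sources, verbatim

S. Lang, *Cyclotomic Fields I and II*, GTM 121, Ch. 1 §3 Thm. 3.1 («For non-trivial `χ`, the ideal
`B_{1,χ̄} I_χ` annihilates `𝒞^{(p)}(χ)`»), Lemma 1 (ii), Cor. 1–3. L. C. Washington, *Introduction to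
Cyclotomic Fields*, GTM 83, Thm. 6.10 (Stickelberger for abelian `K ⊆ ℚ(ζ_m)`), Thm. 14.1
(Kronecker–Weber: «Let `K/ℚ` be a finite abelian extension. Then `K ⊆ ℚ(ζₙ)` for some `n`») — cite-only
(acq-01236), in the tree as `JacobiSumIdeal.mk0_prod_comap_pow_stickelberger_subfield_eq_one` and
`GaloisRepresentations.KroneckerWeber_holds`. D. Solomon, *On the classgroups of imaginary abelian
fields*, Ann. Inst. Fourier 40 (1990), §I pp. 467–468 («although there is a natural generalization of
`(Cl(K) ⊗ 𝓞)^χ` for any `K` as above, without the restriction that `p ∤ [K : ℚ]` it is no longer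
independent of `K`. Therefore … we shall specify `K` to be the field "cut out by `χ`" (that is,
`ker χ = Gal(ℚ̄/K)`)»), Rem. II.1 (a), (c) p. 472.

## What is proved

* §1 `classGroupChiCard_eq_one_of_norm_generalizedBernoulli_eq_one_of_isAbelianGalois_of_algebra_cyclotomic`
  — `K ⊆ M = ℚ(μ_n)` abelian (`[Algebra K M]`, `IsCyclotomicExtension {n} ℚ M`), `f ∣ n`, `p ∤ [K:ℚ]`,
  the other hypotheses verbatim ⟹ `#e_θ(ℤ_p ⊗ Cl K) = 1`. Inside: the inflation `θ_M` and its dictionary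
  (third file), `F₀ = ℚ(ζ_n^{n/f})`, the factorisation `θ_M = θ₀ ∘ res`, the cut-out field
  `K₁ = K^{ker θ} = fixedField (ker θ)` with `θ = θ₁ ∘ res`, the embedding `K₁ → F₀` (Galois
  correspondence in `M`), `θ₀ =` inflation of `θ₁`, the fourth file on `K₁ ⊆ F₀`, the third file's norm
  transport `K₁ ← K`.
* §2 `classGroupChiCard_eq_one_of_norm_generalizedBernoulli_eq_one_of_isAbelianGalois` — abstract
  abelian `K`: `K ≅ L ⊆ ℚ̄`, Kronecker–Weber `L ⊆ ℚ(ζ : ζ^N = 1) ⊆ ℚ(ζ_{Nf}) = C`, and §1 for `K → C`.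

## References

* [Lang1990] Ch. 1 §3 Thm. 3.1, Lemma 1, Cor. 1–3. [Washington1997] Thm. 6.10, Thm. 14.1 (cite-only).
* [Solomon1990] §I pp. 467–468, §II.1–2 pp. 469–471, Rem. II.1 (a), (c) p. 472.
* [MazurWiles1984] Introduction, Thm. 2 (the named fact; not discharged).
* Tree: the four previous files of this series; `GaloisRepresentations/KroneckerWeberTheorem.lean`
  (`KroneckerWeber_holds`); Mathlib `IntermediateField.fixedField`, `IsGalois.fixedField_fixingSubgroup`,
  `IntermediateField.restrictNormalHom_ker`, `IsCyclotomicExtension.Rat.galEquivZMod_restrictNormal_apply`.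
-/

noncomputable section

open NumberField IsDedekindDomain
open scoped TensorProduct nonZeroDivisors
open Literature.RepresentationTheory.FiniteGroups
open Literature.NumberTheory.LFunctions (generalizedBernoulli)

namespace Literature.NumberTheory.NumberFields

/-! ## §1 Abelian `K` inside `ℚ(μ_n)`, `p ∤ [K:ℚ]` only -/

section InsideCyclotomic

open StickelbergerHerbrand

variable {p : ℕ} [Fact p.Prime] {f n : ℕ} [NeZero f] [NeZero n] {K : Type} [Field K] [NumberField K]
  [IsAbelianGalois ℚ K]

/-- **The Herbrand–Stickelberger direction for every abelian `K ⊆ ℚ(μ_n)` with `p ∤ [K:ℚ]`.** Let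
`M = ℚ(μ_n)` (`IsCyclotomicExtension {n} ℚ M`), `K ⊆ M` (`[Algebra K M]`) abelian over `ℚ` with
`p ∤ [K : ℚ]` — NO hypothesis on `[M : ℚ]` — `θ : Gal(K/ℚ) →* ℤ_pˣ` with PRIMITIVE `ℚ_p`-valued Dirichlet
avatar `χ` mod `f`, `f ∣ n` (`IsDirichletAvatar K θ χ m`), `χ` odd, «`χ ≠ ω`»
(`¬ (f = p ∧ ∀ a, p ∤ a → ‖χ(a) − a‖_p < 1)`), `‖B_{1,χ⁻¹}‖_p = 1`. Then `#e_θ(ℤ_p ⊗ Cl K) = 1`. Road: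
the inflation `θ_M = θ ∘ (σ ↦ σ|_K) = χ ∘ (c_n mod f)` factors through `Gal(F₀/ℚ)`, `F₀ = ℚ(μ_f) ⊆ M`, as
`θ₀`; the field `K₁ = K^{ker θ}` «cut out by `θ`» (Solomon) maps into `F₀` and `θ₀` is the inflation of
the faithful character `θ₁` of `Gal(K₁/ℚ)` induced by `θ`; Stickelberger's theorem for `K₁ ⊆ ℚ(μ_f)`
(fourth file) gives `e_{θ₁}(ℤ_p ⊗ Cl K₁) = 0`, and the norm `Cl K → Cl K₁` (third file §2, `p ∤ [K:ℚ]`)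
gives `e_θ(ℤ_p ⊗ Cl K) = 0`. The named fact is not discharged.
[cite: Lang1990, Ch. 1 §3 Thm. 3.1, Lemma 1 (ii), Cor. 1–3] [cite: Washington1997, Thm. 6.10]
[cite: Solomon1990, §I pp. 467–468 (the field cut out by χ; independence of K for p ∤ |G|), Rem. II.1 (a), (c) p. 472] -/
theorem classGroupChiCard_eq_one_of_norm_generalizedBernoulli_eq_one_of_isAbelianGalois_of_algebra_cyclotomic
    (M : Type) [Field M] [NumberField M] [Algebra K M] [IsCyclotomicExtension {n} ℚ M]
    (hfn : f ∣ n) (hK : ¬ p ∣ Module.finrank ℚ K) (θ : (K ≃ₐ[ℚ] K) →* ℤ_[p]ˣ)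
    (χ : DirichletCharacter ℚ_[p] f) (m : ℕ) (hχ : χ.IsPrimitive) (hθχ : IsDirichletAvatar K θ χ m)
    (hodd : χ.Odd)
    (hω : ¬ (f = p ∧ ∀ a : ℤ, ¬ ((p : ℤ) ∣ a) → ‖χ (a : ZMod f) - (a : ℚ_[p])‖ < 1))
    (hB : ‖(generalizedBernoulli 1 χ⁻¹ : ℚ_[p])‖ = 1) :
    classGroupChiCard ℚ K p (fun g => ((θ g : ℤ_[p]ˣ) : ℤ_[p])) = 1 := by
  classical
  haveI : IsGalois ℚ M := IsCyclotomicExtension.isGalois {n} ℚ M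
  have hp : p.Prime := Fact.out
  have hresK : ∀ σ : M ≃ₐ[ℚ] M, AlgEquiv.restrictNormalHom (K₁ := M) K σ = σ.restrictNormal K :=
    fun _ => rfl
  -- ### the inflation `θ_M` of `θ` to `Gal(M/ℚ)` and its dictionary at level `n` (third file)
  set θM : (M ≃ₐ[ℚ] M) →* ℤ_[p]ˣ := θ.comp (AlgEquiv.restrictNormalHom K) with hθM
  have havM : IsDirichletAvatar M θM χ m := isDirichletAvatar_comp_restrictNormalHom θ χ hθχ
  have havMn : IsDirichletAvatar M θM (DirichletCharacter.changeLevel hfn χ) (m * n) := by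
    refine ⟨Nat.mul_pos havM.1 (NeZero.pos n), fun ℓ hℓ hℓmn w hw σ hσ => ?_⟩
    have hℓm : ¬ ℓ ∣ m := fun h => hℓmn (Dvd.dvd.mul_right h n)
    have hℓn : ¬ ℓ ∣ n := fun h => hℓmn (Dvd.dvd.mul_left h m)
    rw [havM.2 ℓ hℓ hℓm w hw σ hσ]
    have hu : IsUnit (ℓ : ZMod n) :=
      (ZMod.isUnit_iff_coprime ℓ n).mpr ((Nat.Prime.coprime_iff_not_dvd hℓ).mpr hℓn)
    rw [← hu.unit_spec, DirichletCharacter.changeLevel_eq_cast_of_dvd χ hfn, hu.unit_spec,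
      ZMod.cast_natCast hfn]
  have hdictM : ∀ σ : M ≃ₐ[ℚ] M, (((θM σ : ℤ_[p]ˣ) : ℤ_[p]) : ℚ_[p]) =
      DirichletCharacter.changeLevel hfn χ
        ((IsCyclotomicExtension.Rat.galEquivZMod n M σ : (ZMod n)ˣ) : ZMod n) :=
    fun σ => coe_apply_eq_dirichlet_of_isDirichletAvatar θM _ havMn σ
  -- ### `F₀ = ℚ(ζ_n^{n/f}) = ℚ(μ_f) ⊆ M` and the factorisation `θ_M = θ₀ ∘ res₀`
  have hζ := IsCyclotomicExtension.zeta_spec n ℚ M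
  have hζ₀ : IsPrimitiveRoot (IsCyclotomicExtension.zeta n ℚ M ^ (n / f)) f := by
    have hnf0 : n / f ≠ 0 := (Nat.div_pos (Nat.le_of_dvd (NeZero.pos n) hfn) (NeZero.pos f)).ne'
    have h := hζ.pow_of_dvd hnf0 (Nat.div_dvd_of_dvd hfn)
    rwa [Nat.div_div_self hfn (NeZero.ne n)] at h
  let F₀ : IntermediateField ℚ M := IntermediateField.adjoin ℚ {IsCyclotomicExtension.zeta n ℚ M ^ (n / f)}
  haveI hF₀ : IsCyclotomicExtension {f} ℚ F₀ := hζ₀.intermediateField_adjoin_isCyclotomicExtension ℚ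
  haveI : IsGalois ℚ F₀ := IsCyclotomicExtension.isGalois {f} ℚ F₀
  have hresF₀ : ∀ σ : M ≃ₐ[ℚ] M, AlgEquiv.restrictNormalHom (K₁ := M) F₀ σ = σ.restrictNormal F₀ :=
    fun _ => rfl
  set res₀ : (M ≃ₐ[ℚ] M) →* (F₀ ≃ₐ[ℚ] F₀) := AlgEquiv.restrictNormalHom (K₁ := M) F₀
  have hres₀s : Function.Surjective res₀ :=
    AlgEquiv.restrictNormalHom_surjective (F := ℚ) (K₁ := F₀) (E := M)
  have hdict₀ : ∀ σ : M ≃ₐ[ℚ] M, (((θM σ : ℤ_[p]ˣ) : ℤ_[p]) : ℚ_[p]) =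
      χ ((IsCyclotomicExtension.Rat.galEquivZMod f F₀ (res₀ σ) : (ZMod f)ˣ) : ZMod f) := by
    intro σ
    rw [hdictM σ, DirichletCharacter.changeLevel_eq_cast_of_dvd χ hfn, ← ZMod.unitsMap_val hfn,
      ← IsCyclotomicExtension.Rat.galEquivZMod_restrictNormal_apply n M F₀ hfn σ]
    rfl
  have hkerle : res₀.ker ≤ θM.ker := by
    intro σ hσ
    rw [MonoidHom.mem_ker] at hσ ⊢
    have h := hdict₀ σ
    rw [hσ, map_one, Units.val_one, map_one] at h
    have h1 : ((θM σ : ℤ_[p]ˣ) : ℤ_[p]) = 1 := by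
      apply Subtype.val_injective
      rw [PadicInt.coe_one]
      exact h
    exact Units.ext (by rw [Units.val_one]; exact h1)
  let e := QuotientGroup.quotientKerEquivOfSurjective res₀ hres₀s
  let θ₀ : (F₀ ≃ₐ[ℚ] F₀) →* ℤ_[p]ˣ := (QuotientGroup.lift res₀.ker θM hkerle).comp e.symm.toMonoidHom
  have hθ₀ : ∀ σ : M ≃ₐ[ℚ] M, θ₀ (res₀ σ) = θM σ := by
    intro σ
    change QuotientGroup.lift res₀.ker θM hkerle (e.symm (res₀ σ)) = θM σ
    have he : e.symm (res₀ σ) = QuotientGroup.mk σ := by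
      rw [MulEquiv.symm_apply_eq]
      rfl
    rw [he, QuotientGroup.lift_mk]
  -- the Dirichlet avatar of `θ₀` is `χ` (a Frobenius of `ℚ(μ_f)` at `v ∣ ℓ` is `σ_ℓ`, first file §1)
  have hav₀ : IsDirichletAvatar F₀ θ₀ χ (m * n) := by
    refine ⟨Nat.mul_pos havM.1 (NeZero.pos n), fun ℓ hℓ hℓmn v hv τ hτ => ?_⟩
    have hℓn : ¬ ℓ ∣ n := fun h => hℓmn (Dvd.dvd.mul_left h m)
    have hℓf : ¬ ℓ ∣ f := fun h => hℓn (h.trans hfn)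
    have hcτ := galEquivZMod_eq_natCast_of_isArithFrobAt (K := F₀) hℓ hℓf hv hτ
    obtain ⟨σ, rfl⟩ := hres₀s τ
    rw [hθ₀ σ, hdict₀ σ, hcτ]
  -- ### the field `K₁ = K^{ker θ}` cut out by `θ`, and the faithful `θ₁` with `θ = θ₁ ∘ res₁`
  set K₁ : IntermediateField ℚ K := IntermediateField.fixedField θ.ker with hK₁
  /- `K₁/ℚ` is abelian (sub-extension of an abelian extension). Mathlib's number-field lemmas find the
  `ℚ`-algebra structure `DivisionRing.toRatAlgebra` on `K₁` first; it agrees definitionally with the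
  structural one of the intermediate field, and statements about the latter are re-typed by ascription. -/
  haveI : IsAbelianGalois ℚ K₁ := IsAbelianGalois.tower_bot ℚ K₁ K
  haveI : IsGalois K₁ K := IsGalois.tower_top_of_isGalois ℚ K₁ K
  have hresK₁ : ∀ σ : K ≃ₐ[ℚ] K, AlgEquiv.restrictNormalHom (K₁ := K) K₁ σ = σ.restrictNormal K₁ :=
    fun _ => rfl
  have hres₁s : Function.Surjective (AlgEquiv.restrictNormalHom (K₁ := K) K₁) :=
    AlgEquiv.restrictNormalHom_surjective (F := ℚ) (K₁ := K₁) (E := K)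
  have hker₁ : (AlgEquiv.restrictNormalHom (K₁ := K) K₁).ker = θ.ker := by
    have h : (AlgEquiv.restrictNormalHom (K₁ := K) K₁).ker = K₁.fixingSubgroup :=
      IntermediateField.restrictNormalHom_ker K₁
    rw [h, hK₁, IntermediateField.fixingSubgroup_fixedField]
  let e₁ := QuotientGroup.quotientKerEquivOfSurjective (AlgEquiv.restrictNormalHom (K₁ := K) K₁) hres₁s
  let θ₁ : (K₁ ≃ₐ[ℚ] K₁) →* ℤ_[p]ˣ :=
    (QuotientGroup.lift (AlgEquiv.restrictNormalHom (K₁ := K) K₁).ker θ hker₁.le).comp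
      e₁.symm.toMonoidHom
  have hθ₁ : ∀ σ : K ≃ₐ[ℚ] K, θ₁ (AlgEquiv.restrictNormalHom (K₁ := K) K₁ σ) = θ σ := by
    intro σ
    change QuotientGroup.lift _ θ hker₁.le (e₁.symm (AlgEquiv.restrictNormalHom (K₁ := K) K₁ σ)) = θ σ
    have he : e₁.symm (AlgEquiv.restrictNormalHom (K₁ := K) K₁ σ) = QuotientGroup.mk σ := by
      rw [MulEquiv.symm_apply_eq]
      rfl
    rw [he, QuotientGroup.lift_mk]
  have hθ₁comp : θ₁.comp (AlgEquiv.restrictNormalHom (K₁ := K) K₁) = θ := MonoidHom.ext hθ₁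
  -- ### `K₁ ⊆ F₀` inside `M`: `Gal(M/F₀) = ker res₀ ⊆ ker θ_M` fixes the image of `K^{ker θ}`
  have hF₀ker : ∀ σ ∈ F₀.fixingSubgroup, σ ∈ res₀.ker := by
    intro σ hσ
    rw [IntermediateField.mem_fixingSubgroup_iff] at hσ
    rw [MonoidHom.mem_ker, hresF₀]
    refine AlgEquiv.ext fun x => (algebraMap F₀ M).injective ?_
    rw [AlgEquiv.restrictNormal_commutes, AlgEquiv.one_apply]
    exact hσ _ x.2
  have hmem : ∀ x : K₁, algebraMap K M (algebraMap K₁ K x) ∈ F₀ := by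
    intro x
    rw [← IsGalois.fixedField_fixingSubgroup F₀, IntermediateField.mem_fixedField_iff]
    intro σ hσ
    have hσK : σ.restrictNormal K ∈ θ.ker := by
      have h := hkerle (hF₀ker σ hσ)
      rw [MonoidHom.mem_ker] at h ⊢
      rw [← h, hθM, MonoidHom.comp_apply, hresK]
    have hx2 : (algebraMap K₁ K x : K) ∈ IntermediateField.fixedField θ.ker := by
      rw [← hK₁]; exact x.2
    have hx : (σ.restrictNormal K) (algebraMap K₁ K x) = algebraMap K₁ K x :=
      (IntermediateField.mem_fixedField_iff θ.ker _).mp hx2 _ hσK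
    rw [← AlgEquiv.restrictNormal_commutes, hx]
  let φ : K₁ →ₐ[ℚ] F₀ :=
    { toFun := fun x => ⟨algebraMap K M (algebraMap K₁ K x), hmem x⟩
      map_one' := Subtype.ext (by simp)
      map_mul' := fun x y => Subtype.ext (by simp)
      map_zero' := Subtype.ext (by simp)
      map_add' := fun x y => Subtype.ext (by simp)
      commutes' := fun q => Subtype.ext (by
        change algebraMap K M (algebraMap K₁ K (algebraMap ℚ K₁ q)) = algebraMap F₀ M (algebraMap ℚ F₀ q)
        rw [← IsScalarTower.algebraMap_apply, ← IsScalarTower.algebraMap_apply,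
          ← IsScalarTower.algebraMap_apply]) }
  letI : Algebra K₁ F₀ := φ.toRingHom.toAlgebra
  have hKF : ∀ x : K₁, algebraMap K M (algebraMap K₁ K x) = algebraMap F₀ M (algebraMap K₁ F₀ x) :=
    fun _ => rfl
  have hinj : Function.Injective (fun x : K₁ => algebraMap K M (algebraMap K₁ K x)) :=
    (algebraMap K M).injective.comp (algebraMap K₁ K).injective
  -- ### `θ₀` is the inflation of `θ₁` along `Gal(F₀/ℚ) → Gal(K₁/ℚ)`
  have hθ₀eq : θ₁.comp (AlgEquiv.restrictNormalHom (K₁ := F₀) K₁) = θ₀ := by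
    refine MonoidHom.ext fun τ => ?_
    obtain ⟨σ, rfl⟩ := hres₀s τ
    rw [hθ₀ σ]
    change θ₁ ((res₀ σ).restrictNormal K₁) = θ (σ.restrictNormal K)
    rw [← hθ₁ (σ.restrictNormal K), hresK₁]
    congr 1
    refine AlgEquiv.ext fun x => hinj ?_
    change algebraMap K M (algebraMap K₁ K ((res₀ σ).restrictNormal K₁ x)) =
      algebraMap K M (algebraMap K₁ K ((σ.restrictNormal K).restrictNormal K₁ x))
    rw [hKF, AlgEquiv.restrictNormal_commutes, hresF₀, AlgEquiv.restrictNormal_commutes, ← hKF,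
      AlgEquiv.restrictNormal_commutes, AlgEquiv.restrictNormal_commutes]
  have hav₁ : IsDirichletAvatar F₀ (θ₁.comp (AlgEquiv.restrictNormalHom (K₁ := F₀) K₁)) χ (m * n) := by
    rw [hθ₀eq]; exact hav₀
  -- ### degrees: `p ∤ [K₁:ℚ]`, `p ∤ |Gal(K/ℚ)|`, `p ∤ |Gal(K/K₁)|`
  have htower : Module.finrank ℚ K₁ * Module.finrank K₁ K = Module.finrank ℚ K :=
    Module.finrank_mul_finrank ℚ K₁ K
  have hK₁p : ¬ p ∣ Module.finrank ℚ K₁ := fun h => hK (by rw [← htower]; exact Dvd.dvd.mul_right h _)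
  have hGK : IsUnit ((Fintype.card (K ≃ₐ[ℚ] K) : ℕ) : ℤ_[p]) := by
    rw [PadicInt.isUnit_iff, PadicInt.norm_natCast_eq_one_iff, ← Nat.card_eq_fintype_card,
      IsGalois.card_aut_eq_finrank]
    exact (Nat.Prime.coprime_iff_not_dvd hp).mpr hK
  have hH : IsUnit ((Fintype.card (K ≃ₐ[K₁] K) : ℕ) : ℤ_[p]) := by
    rw [PadicInt.isUnit_iff, PadicInt.norm_natCast_eq_one_iff, ← Nat.card_eq_fintype_card,
      IsGalois.card_aut_eq_finrank]
    refine (Nat.Prime.coprime_iff_not_dvd hp).mpr fun h => hK ?_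
    rw [← htower]
    exact Dvd.dvd.mul_left h _
  -- ### fourth file on `K₁ ⊆ F₀ = ℚ(μ_f)`: `e_{θ₁}(ℤ_p ⊗ Cl K₁) = 0`
  have hcard₁ := classGroupChiCard_eq_one_of_norm_generalizedBernoulli_eq_one_subfield_of_odd'
    (K₁ := K₁) F₀ hK₁p θ₁ χ (m * n) hχ hav₁ hodd hω hB
  have hbot₁ : classGroupChiComponent ℚ K₁ p (fun g => ((θ₁ g : ℤ_[p]ˣ) : ℤ_[p])) = ⊥ := by
    rw [classGroupChiCard, Nat.card_eq_one_iff_unique] at hcard₁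
    obtain ⟨hsub, -⟩ := hcard₁
    rw [Submodule.eq_bot_iff]
    intro x hx
    exact congrArg Subtype.val
      (Subsingleton.elim (⟨x, hx⟩ : classGroupChiComponent ℚ K₁ p _) ⟨0, Submodule.zero_mem _⟩)
  -- ### third file §2: up the norm `K₁ ← K`
  have hbotK := classGroupChiComponent_eq_bot_of_classGroupChiComponent_norm_eq_bot
    (F₀ := K₁) (M := K) hGK hH θ₁ hbot₁
  rw [hθ₁comp] at hbotK
  rw [classGroupChiCard, hbotK]
  exact Nat.card_unique

end InsideCyclotomic

/-! ## §2 Every abelian number field (Kronecker–Weber) -/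

section Abelian

/-- **The Herbrand–Stickelberger direction of Mazur–Wiles' Theorem 2 for EVERY finite abelian `K/ℚ`,
hypotheses verbatim.** `K/ℚ` finite abelian (`IsAbelianGalois ℚ K`) with `p ∤ [K : ℚ]`,
`θ : Gal(K/ℚ) →* ℤ_pˣ` with PRIMITIVE `ℚ_p`-valued Dirichlet avatar `χ` mod `f`
(`IsDirichletAvatar K θ χ m`), `χ` odd, «`χ ≠ ω`» (`¬ (f = p ∧ ∀ a, p ∤ a → ‖χ(a) − a‖_p < 1)`) and
`‖B_{1,χ⁻¹}‖_p = 1` ⟹ `#e_θ(ℤ_p ⊗ Cl K) = 1`. This is the consumers' lemma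
`classGroupChiCard_eq_one_of_norm_generalizedBernoulli_eq_one` of
`ImaginaryAbelianClassGroupOddPartBernoulli.lean` with the hypothesis
`(h : MazurWiles1984.thm2_oddChiPart_classGroup_card_eq_pow_val_bernoulli)` REMOVED (and `p ≠ 2` not
needed). Kronecker–Weber (tree `KroneckerWeber_holds`, Washington Thm. 14.1) embeds `K ≅ L ⊆ ℚ̄` into
`C = ℚ(ζ_{Nf}) ⊆ ℚ̄`, and §1 applies to `K → C`. HONEST FRAMING: the named fact (the equality
`#A_K^θ = p^{v_p(B_{1,χ⁻¹})}`) is NOT discharged; no summit statement is proved.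
[cite: Lang1990, Ch. 1 §3 Thm. 3.1, Lemma 1 (ii), Cor. 1–3] [cite: Washington1997, Thm. 6.10, Thm. 14.1]
[cite: Solomon1990, §I pp. 467–468, Rem. II.1 (a), (c) p. 472] -/
theorem classGroupChiCard_eq_one_of_norm_generalizedBernoulli_eq_one_of_isAbelianGalois
    {p : ℕ} [Fact p.Prime] (K : Type) [Field K] [NumberField K] [IsAbelianGalois ℚ K]
    (hK : ¬ p ∣ Module.finrank ℚ K) (θ : (K ≃ₐ[ℚ] K) →* ℤ_[p]ˣ) (f : ℕ) [NeZero f]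
    (χ : DirichletCharacter ℚ_[p] f) (m : ℕ) (hχ : χ.IsPrimitive) (hθχ : IsDirichletAvatar K θ χ m)
    (hodd : χ.Odd)
    (hω : ¬ (f = p ∧ ∀ a : ℤ, ¬ ((p : ℤ) ∣ a) → ‖χ (a : ZMod f) - (a : ℚ_[p])‖ < 1))
    (hB : ‖(generalizedBernoulli 1 χ⁻¹ : ℚ_[p])‖ = 1) :
    classGroupChiCard ℚ K p (fun g => ((θ g : ℤ_[p]ˣ) : ℤ_[p])) = 1 := by
  classical
  -- `K ≅ L ⊆ ℚ̄`
  let ι : K →ₐ[ℚ] AlgebraicClosure ℚ := IsAlgClosed.lift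
  let L : IntermediateField ℚ (AlgebraicClosure ℚ) := (⊤ : IntermediateField ℚ K).map ι
  let e : K ≃ₐ[ℚ] L := IntermediateField.topEquiv.symm.trans (IntermediateField.equivMap ⊤ ι)
  have hLfd : FiniteDimensional ℚ L := LinearEquiv.finiteDimensional e.toLinearEquiv
  have hLab : IsAbelianGalois ℚ L := IsAbelianGalois.of_algHom e.symm.toAlgHom
  -- Kronecker–Weber: `L ⊆ ℚ(ζ : ζ^N = 1)` (the `ℚ`-algebra structures on `ℚ̄` in play — Mathlib's
  -- `DivisionRing.toRatAlgebra` and the structural one of the statement — agree definitionally)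
  obtain ⟨N, hN0, hLN⟩ :=
    Literature.NumberTheory.GaloisRepresentations.KroneckerWeber_holds L hLfd hLab
  haveI : Algebra.IsAlgebraic ℚ (AlgebraicClosure ℚ) := AlgebraicClosure.isAlgebraic ℚ
  -- the cyclotomic field `C = ℚ(ζ_{Nf}) ⊆ ℚ̄`
  haveI : NeZero (N * f) := ⟨Nat.mul_ne_zero hN0.ne' (NeZero.ne f)⟩
  haveI : NeZero ((N * f : ℕ) : ℚ) := ⟨by exact_mod_cast (NeZero.ne (N * f))⟩
  obtain ⟨ζ, hζ⟩ := HasEnoughRootsOfUnity.exists_primitiveRoot (AlgebraicClosure ℚ) (N * f)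
  let C : IntermediateField ℚ (AlgebraicClosure ℚ) := IntermediateField.adjoin ℚ {ζ}
  have hC : IsCyclotomicExtension {N * f} ℚ C := hζ.intermediateField_adjoin_isCyclotomicExtension ℚ
  -- re-typed along `Subsingleton (Algebra ℚ C)` to the `ℚ`-algebra structure §1 speaks about
  haveI hC' : @IsCyclotomicExtension {N * f} ℚ C _ _ DivisionRing.toRatAlgebra := by convert hC
  haveI : FiniteDimensional ℚ C :=
    IntermediateField.adjoin.finiteDimensional (Algebra.IsIntegral.isIntegral ζ)
  haveI : NumberField C := NumberField.mk
  have hLC : L ≤ C := by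
    refine hLN.trans (IntermediateField.adjoin_le_iff.mpr fun x hx => ?_)
    have hxN : x ^ N = 1 := hx
    have hxNf : x ^ (N * f) = 1 := by rw [pow_mul, hxN, one_pow]
    obtain ⟨i, -, rfl⟩ := hζ.eq_pow_of_pow_eq_one hxNf
    exact pow_mem (IntermediateField.subset_adjoin ℚ {ζ} (Set.mem_singleton ζ)) i
  let ψ : K →ₐ[ℚ] C := (IntermediateField.inclusion hLC).comp e.toAlgHom
  letI : Algebra K C := ψ.toRingHom.toAlgebra
  exact classGroupChiCard_eq_one_of_norm_generalizedBernoulli_eq_one_of_isAbelianGalois_of_algebra_cyclotomic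
    C (Dvd.intro_left N rfl) hK θ χ m hχ hθχ hodd hω hB

end Abelian

end Literature.NumberTheory.NumberFields

end
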